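import Mathlib
import HarnessLib
import Summits.Ventures.LatticeQCDFlow.Scaling.AcceptanceGiniFloorSharpWitness

/-!
# LatticeQCDFlow / Scaling — the Gini floor `acc ≥ 1 − √((1/ESS − 1)/3)` is traced at EVERY
# `ESS > 3/4`: equally likely, linearly spaced weights of arbitrary slope

HONEST FRAMING: exact (Metropolis-corrected) sampling algorithms for lattice gauge theory;
figures of merit are autocorrelation/cost numbers at stated couplings and volumes; no
continuum-physics claim.

Venture `LatticeQCDFlow` (cell pub-lqcd), topic `Scaling`; FANOUT row 3 (`s0-u1-a`, S0-B
implementation A, GEN-8).  NEW WORK of the cell (row 3's uniform ramp of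
`Scaling/AcceptanceGiniFloorSharpWitness`, GEN-6, imported, given a free slope `β`), not a published
result; NO definition is introduced.  GEN-6's ramp has the one slope `1/m` and shows that the
CONSTANT `1/3` is best possible (its ESS tends to `12/13`); with a free slope the same identity shows
that the whole Gini piece of the acceptance–ESS envelope (`Scaling/AcceptanceEssEnvelope`) is
approached at every `ESS ∈ (3/4, 1)` — the companion of the zero-inflated corner ramps, which trace
the `8/9` piece below `3/4`.

## The slope ramp (`Fin m`, `m ≥ 2`; model `q ≡ 1/m`; weights `w_i = 1 + β(i − (m−1)/2)`,
## `0 ≤ β`, `β(m − 1) < 2`; target `p_i = w_i/m`)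

* `slopeRamp_weight`, `slopeRamp_pos`, `slopeRamp_sum_eq_one`;
* **`slopeRamp_one_sub_accRate`** — `1 − acc = β(m² − 1)/(6m)`;
  **`slopeRamp_inv_essFrac_sub_one`** — `1/ESS − 1 = β²(m² − 1)/12`;
  **`slopeRamp_sq_one_sub_accRate_eq`** — `(1 − acc)² = ((m² − 1)/m²)·(1/ESS − 1)/3` for EVERY
  slope (GEN-6's identity is the case `β = 1/m`);
* **`exists_accRate_lt_of_essFrac`** — for every `e ∈ (3/4, 1)` and `ε > 0` a finite pair with
  POSITIVE target and model, `essFrac = e` EXACTLY and `acc < 1 − √((1/e − 1)/3) + ε` (slope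
  `β = √(12(1/e − 1)/(m² − 1))`, admissible because `1/e − 1 < 1/3`; `m² > √((1/e − 1)/3)/ε`).

NOT CLAIMED: attainment on a fixed finite space; `e ≤ 3/4` (there the envelope is the `8/9` piece,
`Scaling/AcceptanceEssEightNinthsWitness` / `Scaling/AcceptanceEssEnvelope`); nothing re-scored.
-/

namespace Summit.Ventures.LatticeQCDFlow.Theory2

open Finset
open Literature.Probability.MarkovChains
open Summit.Ventures.LatticeQCDFlow.Exactness

/-- The slope ramp's weights: `w_i = 1 + β(i − (m−1)/2)`. -/
theorem slopeRamp_weight {m : ℕ} (hm : 2 ≤ m) (β : ℝ) (i : Fin m) :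
    weight (fun i : Fin m => ((m : ℝ))⁻¹ * (1 + β * (((i : ℕ) : ℝ) - ((m : ℝ) - 1) / 2)))
        (fun _ : Fin m => ((m : ℝ))⁻¹) i
      = 1 + β * (((i : ℕ) : ℝ) - ((m : ℝ) - 1) / 2) := by
  have hmne : (m : ℝ) ≠ 0 := by exact_mod_cast (by omega : m ≠ 0)
  rw [weight]
  field_simp

/-- The slope ramp target is strictly positive when `β ≥ 0` and `β(m − 1) < 2`
(`w_i ≥ w_0 = 1 − β(m−1)/2 > 0`). -/
theorem slopeRamp_pos {m : ℕ} (hm : 2 ≤ m) {β : ℝ} (hβ0 : 0 ≤ β) (hβ1 : β * ((m : ℝ) - 1) < 2)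
    (i : Fin m) :
    0 < ((m : ℝ))⁻¹ * (1 + β * (((i : ℕ) : ℝ) - ((m : ℝ) - 1) / 2)) := by
  have hm0 : (0 : ℝ) < m := by exact_mod_cast (by omega : 0 < m)
  have hi : (0 : ℝ) ≤ ((i : ℕ) : ℝ) := Nat.cast_nonneg _
  refine mul_pos (inv_pos.2 hm0) ?_
  have h1 : -(β * (((m : ℝ) - 1) / 2)) ≤ β * (((i : ℕ) : ℝ) - ((m : ℝ) - 1) / 2) := by
    nlinarith
  nlinarith

/-- The slope ramp target is normalised. -/
theorem slopeRamp_sum_eq_one {m : ℕ} (hm : 2 ≤ m) (β : ℝ) :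
    ∑ i : Fin m, ((m : ℝ))⁻¹ * (1 + β * (((i : ℕ) : ℝ) - ((m : ℝ) - 1) / 2)) = 1 := by
  have hmne : (m : ℝ) ≠ 0 := by exact_mod_cast (by omega : m ≠ 0)
  have e : ∀ i : Fin m, ((m : ℝ))⁻¹ * (1 + β * (((i : ℕ) : ℝ) - ((m : ℝ) - 1) / 2))
      = ((m : ℝ))⁻¹ * (1 - β * ((m : ℝ) - 1) / 2)
        + ((m : ℝ))⁻¹ * β * ((i : ℕ) : ℝ) := by
    intro i; field_simp; ring
  rw [Finset.sum_congr rfl fun i _ => e i, sum_add_distrib, sum_const, card_univ,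
    Fintype.card_fin, nsmul_eq_mul, ← mul_sum,
    Fin.sum_univ_eq_sum_range (fun i => ((i : ℕ) : ℝ)) m,
    Literature.NumberTheory.EllipticCurves.sum_range_natCast_real]
  field_simp
  ring

/-- **The slope ramp's acceptance deficit**: `1 − acc = β(m² − 1)/(6m)` (`β ≥ 0`). -/
theorem slopeRamp_one_sub_accRate {m : ℕ} (hm : 2 ≤ m) {β : ℝ} (hβ0 : 0 ≤ β) :
    1 - accRate (fun i : Fin m => ((m : ℝ))⁻¹ * (1 + β * (((i : ℕ) : ℝ) - ((m : ℝ) - 1) / 2)))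
        (fun _ : Fin m => ((m : ℝ))⁻¹)
      = β * (((m : ℝ)) ^ 2 - 1) / (6 * (m : ℝ)) := by
  have hm0 : (0 : ℝ) < m := by exact_mod_cast (by omega : 0 < m)
  have hmne : (m : ℝ) ≠ 0 := hm0.ne'
  rw [one_sub_accRate_eq_half_qq_abs_weight (fun _ => inv_pos.2 hm0) (slopeRamp_sum_eq_one hm β)
    (uniform_fin_sum_eq_one hm)]
  have e : ∀ i j : Fin m, ((m : ℝ))⁻¹ * ((m : ℝ))⁻¹ *
      |weight (fun i : Fin m => ((m : ℝ))⁻¹ * (1 + β * (((i : ℕ) : ℝ) - ((m : ℝ) - 1) / 2)))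
          (fun _ : Fin m => ((m : ℝ))⁻¹) i
        - weight (fun i : Fin m => ((m : ℝ))⁻¹ * (1 + β * (((i : ℕ) : ℝ) - ((m : ℝ) - 1) / 2)))
          (fun _ : Fin m => ((m : ℝ))⁻¹) j|
      = (((m : ℝ))⁻¹) ^ 2 * β * |((i : ℕ) : ℝ) - ((j : ℕ) : ℝ)| := by
    intro i j
    rw [slopeRamp_weight hm, slopeRamp_weight hm]
    have : (1 + β * (((i : ℕ) : ℝ) - ((m : ℝ) - 1) / 2)) - (1 + β * (((j : ℕ) : ℝ) - ((m : ℝ) - 1) / 2))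
        = β * (((i : ℕ) : ℝ) - ((j : ℕ) : ℝ)) := by ring
    rw [this, abs_mul, abs_of_nonneg hβ0]
    ring
  simp_rw [e, ← mul_sum]
  rw [sum_fin_fin_eq_sum_range_range m (fun i j => |(i : ℝ) - (j : ℝ)|), sum_range_abs_sub]
  field_simp
  ring

/-- **The slope ramp's ESS**: `1/ESS − 1 = β²(m² − 1)/12`. -/
theorem slopeRamp_inv_essFrac_sub_one {m : ℕ} (hm : 2 ≤ m) (β : ℝ) :
    (essFrac (fun i : Fin m => ((m : ℝ))⁻¹ * (1 + β * (((i : ℕ) : ℝ) - ((m : ℝ) - 1) / 2)))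
        (fun _ : Fin m => ((m : ℝ))⁻¹))⁻¹ - 1
      = β ^ 2 * (((m : ℝ)) ^ 2 - 1) / 12 := by
  have hm0 : (0 : ℝ) < m := by exact_mod_cast (by omega : 0 < m)
  have hmne : (m : ℝ) ≠ 0 := hm0.ne'
  have h2 := qq_sq_sub_weight_eq (fun _ => inv_pos.2 hm0) (slopeRamp_sum_eq_one hm β)
    (uniform_fin_sum_eq_one hm) (p := fun i : Fin m =>
      ((m : ℝ))⁻¹ * (1 + β * (((i : ℕ) : ℝ) - ((m : ℝ) - 1) / 2))) (q := fun _ : Fin m => ((m : ℝ))⁻¹)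
  have e : ∀ i j : Fin m, ((m : ℝ))⁻¹ * ((m : ℝ))⁻¹ *
      (weight (fun i : Fin m => ((m : ℝ))⁻¹ * (1 + β * (((i : ℕ) : ℝ) - ((m : ℝ) - 1) / 2)))
          (fun _ : Fin m => ((m : ℝ))⁻¹) i
        - weight (fun i : Fin m => ((m : ℝ))⁻¹ * (1 + β * (((i : ℕ) : ℝ) - ((m : ℝ) - 1) / 2)))
          (fun _ : Fin m => ((m : ℝ))⁻¹) j) ^ 2
      = (((m : ℝ))⁻¹) ^ 2 * β ^ 2 * (((i : ℕ) : ℝ) - ((j : ℕ) : ℝ)) ^ 2 := by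
    intro i j
    rw [slopeRamp_weight hm, slopeRamp_weight hm]
    field_simp
    ring
  simp_rw [e, ← mul_sum] at h2
  -- `Σ_{i,j<m} (i − j)² = m²(m² − 1)/6` from the two power sums
  have hsq : ∑ i ∈ range m, ∑ j ∈ range m, ((i : ℝ) - j) ^ 2
      = (m : ℝ) ^ 2 * ((m : ℝ) ^ 2 - 1) / 6 := by
    have ei : ∀ i j : ℕ, ((i : ℝ) - j) ^ 2 = (i : ℝ) ^ 2 - 2 * i * j + (j : ℝ) ^ 2 := fun i j => by
      ring
    have hin : ∀ i : ℕ, ∑ j ∈ range m, ((i : ℝ) - j) ^ 2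
        = m * (i : ℝ) ^ 2 - 2 * i * (m * (m - 1) / 2) + m * (m - 1) * (2 * m - 1) / 6 := by
      intro i
      simp_rw [ei]
      rw [sum_add_distrib, sum_sub_distrib, sum_const, card_range, nsmul_eq_mul, ← mul_sum,
        Literature.NumberTheory.EllipticCurves.sum_range_natCast_real,
        Literature.NumberTheory.EllipticCurves.sum_range_natCast_sq_real]
    simp_rw [hin]
    rw [sum_add_distrib, sum_sub_distrib, sum_const, card_range, nsmul_eq_mul, ← mul_sum,
      Literature.NumberTheory.EllipticCurves.sum_range_natCast_sq_real]
    have e3 : ∑ i ∈ range m, 2 * (i : ℝ) * ((m : ℝ) * ((m : ℝ) - 1) / 2)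
        = 2 * ((m : ℝ) * ((m : ℝ) - 1) / 2) * ((m : ℝ) * ((m : ℝ) - 1) / 2) := by
      rw [← Literature.NumberTheory.EllipticCurves.sum_range_natCast_real, mul_sum]
      exact sum_congr rfl fun i _ => by ring
    rw [e3]
    ring
  rw [sum_fin_fin_eq_sum_range_range m (fun i j => ((i : ℝ) - (j : ℝ)) ^ 2), hsq] at h2
  have e2 : β ^ 2 * (((m : ℝ)) ^ 2 - 1) / 12
      = ((((m : ℝ))⁻¹) ^ 2 * β ^ 2 * ((m : ℝ) ^ 2 * ((m : ℝ) ^ 2 - 1) / 6)) / 2 := by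
    field_simp
    ring
  rw [e2]
  linarith [h2]

/-- **The slope-free identity**: `(1 − acc)² = ((m² − 1)/m²)·((1/ESS − 1)/3)` for every slope
`β ≥ 0` — GEN-6's `uniformRamp_sq_one_sub_accRate_eq` is the case `β = 1/m`. -/
theorem slopeRamp_sq_one_sub_accRate_eq {m : ℕ} (hm : 2 ≤ m) {β : ℝ} (hβ0 : 0 ≤ β) :
    (1 - accRate (fun i : Fin m => ((m : ℝ))⁻¹ * (1 + β * (((i : ℕ) : ℝ) - ((m : ℝ) - 1) / 2)))
        (fun _ : Fin m => ((m : ℝ))⁻¹)) ^ 2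
      = (((m : ℝ)) ^ 2 - 1) / (3 * (m : ℝ) ^ 2)
        * ((essFrac (fun i : Fin m => ((m : ℝ))⁻¹ * (1 + β * (((i : ℕ) : ℝ) - ((m : ℝ) - 1) / 2)))
            (fun _ : Fin m => ((m : ℝ))⁻¹))⁻¹ - 1) := by
  have hmne : (m : ℝ) ≠ 0 := by exact_mod_cast (by omega : m ≠ 0)
  rw [slopeRamp_one_sub_accRate hm hβ0, slopeRamp_inv_essFrac_sub_one hm]
  field_simp
  ring

/-- **The Gini floor is approached at every `ESS ∈ (3/4, 1)`.**  For every such `e` and every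
`ε > 0` there is a finite pair with positive target and model, `essFrac = e` exactly and
`acc < 1 − √((1/e − 1)/3) + ε`. [folklore] -/
theorem exists_accRate_lt_of_essFrac {e ε : ℝ} (he0 : 3 / 4 < e) (he1 : e < 1) (hε : 0 < ε) :
    ∃ (m : ℕ) (p q : Fin m → ℝ), (∀ i, 0 < p i) ∧ (∀ i, 0 < q i) ∧ ∑ i, p i = 1 ∧ ∑ i, q i = 1 ∧
      essFrac p q = e ∧ accRate p q < 1 - Real.sqrt ((e⁻¹ - 1) / 3) + ε := by
  -- `V = 1/e − 1 ∈ (0, 1/3)`, `S = √(V/3)`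
  set V : ℝ := e⁻¹ - 1 with hV
  have he : 0 < e := by linarith
  have hV0 : 0 < V := by
    rw [hV, sub_pos]; exact one_lt_inv_iff₀.mpr ⟨he, he1⟩
  have hV3 : V < 1 / 3 := by
    rw [hV]
    have : e⁻¹ < 4 / 3 := by
      rw [inv_lt_comm₀ he (by norm_num)]
      linarith
    linarith
  set S : ℝ := Real.sqrt (V / 3) with hS
  have hS0 : 0 ≤ S := Real.sqrt_nonneg _
  -- choose `m ≥ 2` with `m² > S/ε`
  obtain ⟨m₀, hm₀⟩ := exists_nat_gt (S / ε)
  set m := m₀ + 2 with hm_def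
  have hm : 2 ≤ m := by omega
  have hm0 : (0 : ℝ) < m := by exact_mod_cast (by omega : 0 < m)
  have hm2 : (2 : ℝ) ≤ m := by exact_mod_cast hm
  have hmS : S / ε < (m : ℝ) ^ 2 := by
    have : (m₀ : ℝ) ≤ m := by rw [hm_def]; push_cast; linarith
    nlinarith
  have hm21 : 0 < ((m : ℝ)) ^ 2 - 1 := by nlinarith
  -- the slope: `β² (m² − 1)/12 = V`
  set β : ℝ := Real.sqrt (12 * V / ((m : ℝ) ^ 2 - 1)) with hβ
  have hβ0 : 0 ≤ β := Real.sqrt_nonneg _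
  have hβsq : β ^ 2 = 12 * V / ((m : ℝ) ^ 2 - 1) := Real.sq_sqrt (by positivity)
  have hβ1 : β * ((m : ℝ) - 1) < 2 := by
    -- `β²(m−1)² = 12V(m−1)/(m+1) < 4(m−1)/(m+1) ≤ 4`
    have hsq : (β * ((m : ℝ) - 1)) ^ 2 < 2 ^ 2 := by
      rw [mul_pow, hβsq]
      have e1 : ((m : ℝ)) ^ 2 - 1 = (m - 1) * (m + 1) := by ring
      rw [e1, div_mul_eq_mul_div, div_lt_iff₀ (by nlinarith)]
      nlinarith
    have hb : 0 ≤ β * ((m : ℝ) - 1) := mul_nonneg hβ0 (by linarith)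
    nlinarith
  refine ⟨m, fun i : Fin m => ((m : ℝ))⁻¹ * (1 + β * (((i : ℕ) : ℝ) - ((m : ℝ) - 1) / 2)),
    fun _ : Fin m => ((m : ℝ))⁻¹, slopeRamp_pos hm hβ0 hβ1, fun _ => inv_pos.2 hm0,
    slopeRamp_sum_eq_one hm β, uniform_fin_sum_eq_one hm, ?_, ?_⟩
  · -- `essFrac = e`
    have h := slopeRamp_inv_essFrac_sub_one hm β (m := m)
    rw [hβsq] at h
    have h2 : (essFrac (fun i : Fin m => ((m : ℝ))⁻¹ * (1 + β * (((i : ℕ) : ℝ) - ((m : ℝ) - 1) / 2)))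
        (fun _ : Fin m => ((m : ℝ))⁻¹))⁻¹ = e⁻¹ := by
      have : 12 * V / (((m : ℝ)) ^ 2 - 1) * (((m : ℝ)) ^ 2 - 1) / 12 = V := by
        field_simp
      rw [this, hV] at h
      linarith
    exact inv_injective h2
  · -- `acc = 1 − D` with `D² = ((m²−1)/m²)·S²` and `D ≥ (1 − 1/m²)·S ≥ S − S/m² > S − ε`
    set D : ℝ := 1 - accRate (fun i : Fin m => ((m : ℝ))⁻¹ * (1 + β * (((i : ℕ) : ℝ) - ((m : ℝ) - 1) / 2)))
        (fun _ : Fin m => ((m : ℝ))⁻¹) with hD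
    have hDval : D = β * (((m : ℝ)) ^ 2 - 1) / (6 * (m : ℝ)) := slopeRamp_one_sub_accRate hm hβ0
    have hD0 : 0 ≤ D := by rw [hDval]; positivity
    have hD2 : D ^ 2 = (((m : ℝ)) ^ 2 - 1) / (m : ℝ) ^ 2 * S ^ 2 := by
      rw [hDval, hS, Real.sq_sqrt (by positivity), div_pow, mul_pow, hβsq]
      field_simp
      ring
    set c : ℝ := (((m : ℝ)) ^ 2 - 1) / (m : ℝ) ^ 2 with hc
    have hc0 : 0 ≤ c := by positivity
    have hc1 : c ≤ 1 := by
      rw [hc, div_le_one (by positivity)]; linarith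
    have hcS : c * S ≤ D := by
      have h1 : (c * S) ^ 2 ≤ D ^ 2 := by
        rw [hD2, mul_pow]
        have : c ^ 2 ≤ c := by nlinarith
        nlinarith [sq_nonneg S]
      exact (pow_le_pow_iff_left₀ (mul_nonneg hc0 hS0) hD0 two_ne_zero).mp h1
    have hc2 : 1 - c = 1 / (m : ℝ) ^ 2 := by
      rw [hc]
      field_simp
      ring
    have hSm : S / (m : ℝ) ^ 2 < ε := by
      rw [div_lt_iff₀ (by positivity)]
      have := (div_lt_iff₀ hε).mp hmS
      linarith
    have hgoal : accRate (fun i : Fin m => ((m : ℝ))⁻¹ * (1 + β * (((i : ℕ) : ℝ) - ((m : ℝ) - 1) / 2)))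
        (fun _ : Fin m => ((m : ℝ))⁻¹) = 1 - D := by rw [hD]; ring
    rw [hgoal]
    have : S - S / (m : ℝ) ^ 2 ≤ D := by
      have e1 : S - S / (m : ℝ) ^ 2 = (1 - 1 / (m : ℝ) ^ 2) * S := by ring
      rw [e1, ← hc2]
      have : (1 - (1 - c)) * S = c * S := by ring
      rw [this]
      exact hcS
    linarith

end Summit.Ventures.LatticeQCDFlow.Theory2
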